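import Mathlib.GroupTheory.SpecificGroups.Dihedral
import Mathlib.Tactic.Linarith
import Mathlib.Tactic.LinearCombination
import Literature.Combinatorics.Additive.TripleProductProperty
import HarnessLib

/-!
# The uniform dihedral TPP family for every `n ≥ 3`: `β(D_{2n}) ≥ 4⌊2n/3⌋`

ω-census, family (b3).  Framing: lottery ticket; floor = certified bounds/negative ranges.

In `D_{2n} = DihedralGroup n` take `S = {1, s}`, `T = {1, s r}` and
`U = {r^{3i} : 3i ≤ n-2} ∪ {s r^{3i+2} : 3i+2 ≤ n-1}` (`|U| = ⌊(n+1)/3⌋ + ⌊n/3⌋ = ⌊2n/3⌋`).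
Because `S S⁻¹ = {1, s}` and `T T⁻¹ = {1, s r}` consist of involutions, the triple product property for
`(S, T, U)` reduces to `u u'⁻¹ ∉ {s, s r, (s r) s = r⁻¹}` for `u ≠ u'` in `U` (`tpp_of_involution_pair`), and for
this `U` that is elementary modular arithmetic on representatives `< n`.  This extends the kernel lower bound
`β(D_{6m}) ≥ 8m` of `DihedralTPPFamilyGeneral.lean` (the case `3 ∣ n`) to all `n ≥ 3`; together with the
census's SAT/DRAT upper bounds it is the law `β(D_{2n}) = 4⌊2n/3⌋` checked for `4 ≤ n ≤ 19`.
-/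

namespace Summit.MatrixMultiplication.OmegaCensus

open Literature.Combinatorics.Additive Finset

section general

variable {G : Type*} [Group G] [DecidableEq G]

/-- **TPP for a pair of involution pairs.** If `a, b` are involutions with `a ≠ 1`, `b ≠ 1`, `a b ≠ 1` and
`u u'⁻¹ ∉ {a, b, b a}` for all `u ≠ u'` in `U`, then `({1,a}, {1,b}, U)` has the triple product property:
the quotient sets are `{1,a}` and `{1,b}`, so `q_S q_T q_U = 1` forces `q_U ∈ {1, a, b, (ab)⁻¹ = b a}`. [folklore] -/
theorem tpp_of_involution_pair {a b : G} {U : Finset G} (ha : a ≠ 1) (hb : b ≠ 1) (hab : a * b ≠ 1)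
    (haa : a * a = 1) (hbb : b * b = 1)
    (hU : ∀ u ∈ U, ∀ u' ∈ U, u ≠ u' → u * u'⁻¹ ≠ a ∧ u * u'⁻¹ ≠ b ∧ u * u'⁻¹ ≠ b * a) :
    TripleProductProperty ({1, a} : Finset G) ({1, b} : Finset G) U := by
  have ha2 : a⁻¹ = a := inv_eq_of_mul_eq_one_right haa
  have hb2 : b⁻¹ = b := inv_eq_of_mul_eq_one_right hbb
  intro s hs s' hs' t ht t' ht' u hu u' hu' heq
  simp only [mem_insert, mem_singleton] at hs hs' ht ht'
  generalize hqdef : u * u'⁻¹ = q at heq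
  have hq1 : q = 1 ↔ u = u' := by rw [← hqdef, mul_inv_eq_one]
  by_cases huu : u = u'
  · have hq : q = 1 := hq1.mpr huu
    subst hq
    rcases hs with rfl | rfl <;> rcases hs' with rfl | rfl <;> rcases ht with rfl | rfl <;> rcases ht' with rfl | rfl
    all_goals
      simp only [inv_one, mul_one, one_mul, ha2, hb2, haa, hbb] at heq
    all_goals first
      | exact ⟨rfl, rfl, huu⟩
      | exact absurd heq hb
      | exact absurd heq ha
      | exact absurd heq hab
  · exfalso
    obtain ⟨h1, h2, h3⟩ := hU u hu u' hu' huu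
    rw [hqdef] at h1 h2 h3
    have hq : q ≠ 1 := fun h => huu (hq1.mp h)
    rcases hs with rfl | rfl <;> rcases hs' with rfl | rfl <;> rcases ht with rfl | rfl <;> rcases ht' with rfl | rfl
    all_goals
      simp only [inv_one, mul_one, one_mul, ha2, hb2, haa, hbb] at heq
    all_goals first
      | exact hq heq
      | exact h1 ((mul_eq_one_iff_inv_eq.mp heq).symm.trans ha2)
      | exact h2 ((mul_eq_one_iff_inv_eq.mp heq).symm.trans hb2)
      | exact h3 (by rw [← mul_eq_one_iff_inv_eq.mp heq, mul_inv_rev, ha2, hb2])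

end general

/-- Representatives: if `x < n`, `y ≤ n` and `(x : ZMod n) = y` then `x = y`, or `x = 0` and `y = n`. [folklore] -/
theorem natCast_zmod_eq_cases {n x y : ℕ} (hx : x < n) (hy : y ≤ n) (h : (x : ZMod n) = (y : ZMod n)) :
    x = y ∨ (x = 0 ∧ y = n) := by
  rw [ZMod.natCast_eq_natCast_iff', Nat.mod_eq_of_lt hx] at h
  rcases hy.lt_or_eq with hy | rfl
  · left; rwa [Nat.mod_eq_of_lt hy] at h
  · right; rw [Nat.mod_self] at h; exact ⟨h, rfl⟩

/-- **The uniform dihedral TPP family, all `n ≥ 3`** (ω-census, ours): in `D_{2n} = DihedralGroup n` the triple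
`S = {1, s}`, `T = {1, s r}`, `U = {r^{3i} : i < ⌊(n+1)/3⌋} ∪ {s r^{3i+2} : i < ⌊n/3⌋}` has the triple product
property. [folklore] -/
theorem dihedral_uniform_family_tpp (n : ℕ) [NeZero n] (hn : 3 ≤ n) :
    TripleProductProperty ({1, DihedralGroup.sr 0} : Finset (DihedralGroup n))
      ({1, DihedralGroup.sr 1} : Finset (DihedralGroup n))
      (((range ((n + 1) / 3)).image fun i : ℕ => DihedralGroup.r ((3 * i : ℕ) : ZMod n)) ∪
        ((range (n / 3)).image fun i : ℕ => DihedralGroup.sr ((3 * i + 2 : ℕ) : ZMod n))) := by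
  have h10 : ((1 : ℕ) : ZMod n) ≠ ((0 : ℕ) : ZMod n) := by
    intro h
    rcases natCast_zmod_eq_cases (by omega) (by omega) h with h | h <;> omega
  refine tpp_of_involution_pair ?_ ?_ ?_ ?_ ?_ ?_
  · rw [DihedralGroup.one_def]; exact fun h => by cases h
  · rw [DihedralGroup.one_def]; exact fun h => by cases h
  · rw [DihedralGroup.sr_mul_sr, DihedralGroup.one_def, ne_eq, DihedralGroup.r.injEq, sub_zero]
    simpa using h10
  · rw [DihedralGroup.sr_mul_sr, sub_self, DihedralGroup.one_def]
  · rw [DihedralGroup.sr_mul_sr, sub_self, DihedralGroup.one_def]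
  intro u hu u' hu' hne
  simp only [mem_union, mem_image, mem_range] at hu hu'
  have nd : (n + 1) / 3 * 3 ≤ n + 1 := Nat.div_mul_le_self _ _
  have nd' : n / 3 * 3 ≤ n := Nat.div_mul_le_self _ _
  rcases hu with ⟨i, hi, rfl⟩ | ⟨i, hi, rfl⟩ <;> rcases hu' with ⟨i', hi', rfl⟩ | ⟨i', hi', rfl⟩
  · -- r / r : u u'⁻¹ = r (x - x'); must avoid r (-1)
    refine ⟨by simp [DihedralGroup.inv_r, DihedralGroup.r_mul_r],
      by simp [DihedralGroup.inv_r, DihedralGroup.r_mul_r], ?_⟩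
    rw [DihedralGroup.inv_r, DihedralGroup.r_mul_r, DihedralGroup.sr_mul_sr]
    intro h
    have h' := DihedralGroup.r.inj h
    have hc : ((3 * i' : ℕ) : ZMod n) = ((3 * i + 1 : ℕ) : ZMod n) := by
      push_cast at h' ⊢; linear_combination -h'
    rcases natCast_zmod_eq_cases (by omega) (by omega) hc with h2 | h2 <;> omega
  · -- r / sr : u u'⁻¹ = sr (x' - x); must avoid sr 0, sr 1
    rw [DihedralGroup.inv_sr, DihedralGroup.r_mul_sr]
    refine ⟨fun h => ?_, fun h => ?_, by rw [DihedralGroup.sr_mul_sr]; simp⟩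
    · have h' := DihedralGroup.sr.inj h
      have hc : ((3 * i' + 2 : ℕ) : ZMod n) = ((3 * i : ℕ) : ZMod n) := by
        push_cast at h' ⊢; linear_combination h'
      rcases natCast_zmod_eq_cases (by omega) (by omega) hc with h2 | h2 <;> omega
    · have h' := DihedralGroup.sr.inj h
      have hc : ((3 * i' + 2 : ℕ) : ZMod n) = ((3 * i + 1 : ℕ) : ZMod n) := by
        push_cast at h' ⊢; linear_combination h'
      rcases natCast_zmod_eq_cases (by omega) (by omega) hc with h2 | h2 <;> omega
  · -- sr / r : u u'⁻¹ = sr (x - x'); must avoid sr 0, sr 1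
    rw [DihedralGroup.inv_r, DihedralGroup.sr_mul_r]
    refine ⟨fun h => ?_, fun h => ?_, by rw [DihedralGroup.sr_mul_sr]; simp⟩
    · have h' := DihedralGroup.sr.inj h
      have hc : ((3 * i + 2 : ℕ) : ZMod n) = ((3 * i' : ℕ) : ZMod n) := by
        push_cast at h' ⊢; linear_combination h'
      rcases natCast_zmod_eq_cases (by omega) (by omega) hc with h2 | h2 <;> omega
    · have h' := DihedralGroup.sr.inj h
      have hc : ((3 * i + 2 : ℕ) : ZMod n) = ((3 * i' + 1 : ℕ) : ZMod n) := by
        push_cast at h' ⊢; linear_combination h'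
      rcases natCast_zmod_eq_cases (by omega) (by omega) hc with h2 | h2 <;> omega
  · -- sr / sr : u u'⁻¹ = r (x' - x); must avoid r (-1)
    refine ⟨by simp [DihedralGroup.inv_sr, DihedralGroup.sr_mul_sr],
      by simp [DihedralGroup.inv_sr, DihedralGroup.sr_mul_sr], ?_⟩
    rw [DihedralGroup.inv_sr, DihedralGroup.sr_mul_sr, DihedralGroup.sr_mul_sr]
    intro h
    have h' := DihedralGroup.r.inj h
    have hc : ((3 * i + 2 : ℕ) : ZMod n) = ((3 * i' + 3 : ℕ) : ZMod n) := by
      push_cast at h' ⊢; linear_combination -h'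
    rcases natCast_zmod_eq_cases (by omega) (by omega) hc with h2 | h2 <;> omega

/-- The family's third set has exactly `⌊(n+1)/3⌋ + ⌊n/3⌋ = ⌊2n/3⌋` elements. [folklore] -/
theorem dihedral_uniform_family_card (n : ℕ) [NeZero n] :
    (((range ((n + 1) / 3)).image fun i : ℕ => DihedralGroup.r ((3 * i : ℕ) : ZMod n)) ∪
        ((range (n / 3)).image fun i : ℕ => DihedralGroup.sr ((3 * i + 2 : ℕ) : ZMod n)) :
        Finset (DihedralGroup n)).card = 2 * n / 3 := by
  have nd : (n + 1) / 3 * 3 ≤ n + 1 := Nat.div_mul_le_self _ _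
  have nd' : n / 3 * 3 ≤ n := Nat.div_mul_le_self _ _
  rw [card_union_of_disjoint, card_image_of_injOn, card_image_of_injOn, card_range, card_range]
  · omega
  · intro i hi i' hi' h
    simp only [coe_range, Set.mem_Iio] at hi hi'
    have hc := DihedralGroup.sr.inj h
    rcases natCast_zmod_eq_cases (by omega) (by omega) hc with h2 | h2 <;> omega
  · intro i hi i' hi' h
    simp only [coe_range, Set.mem_Iio] at hi hi'
    have hc := DihedralGroup.r.inj h
    rcases natCast_zmod_eq_cases (by omega) (by omega) hc with h2 | h2 <;> omega
  · rw [disjoint_left]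
    intro x hx hx'
    simp only [mem_image, mem_range] at hx hx'
    obtain ⟨j, -, rfl⟩ := hx
    obtain ⟨j', -, h⟩ := hx'
    cases h

/-- **Lower half of the dihedral law, all `n ≥ 3`:** `D_{2n}` has a TPP triple of sizes `(2, 2, ⌊2n/3⌋)`, volume
`4⌊2n/3⌋` — i.e. `β(D_{2n}) ≥ 4⌊2n/3⌋` (for `3 ∣ n` this is `dihedral_family_volume`; the census conjectures
equality for all `n ≥ 4`, confirmed by SAT/DRAT for `n ≤ 19`). [folklore] -/
theorem dihedral_volume_ge_law (n : ℕ) [NeZero n] (hn : 3 ≤ n) :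
    ∃ S T U : Finset (DihedralGroup n), TripleProductProperty S T U ∧ S.card = 2 ∧ T.card = 2 ∧
      U.card = 2 * n / 3 ∧ S.card * T.card * U.card = 4 * (2 * n / 3) := by
  refine ⟨_, _, _, dihedral_uniform_family_tpp n hn, ?_, ?_, dihedral_uniform_family_card n, ?_⟩
  · rw [card_insert_of_notMem (by rw [mem_singleton, DihedralGroup.one_def]; exact fun h => by cases h),
      card_singleton]
  · rw [card_insert_of_notMem (by rw [mem_singleton, DihedralGroup.one_def]; exact fun h => by cases h),
      card_singleton]
  · rw [card_insert_of_notMem (by rw [mem_singleton, DihedralGroup.one_def]; exact fun h => by cases h),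
      card_singleton,
      card_insert_of_notMem (by rw [mem_singleton, DihedralGroup.one_def]; exact fun h => by cases h),
      card_singleton, dihedral_uniform_family_card]

end Summit.MatrixMultiplication.OmegaCensus
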